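import Summits.NavierStokesRegularity.NavierStokesRegularity.Theorems.AdaptedFrequencyAdaptedFrequencyConvergesStubPinchingLowerTools
import Summits.NavierStokesRegularity.NavierStokesRegularity.Theorems.TypeICertificateLadderNoTypeIBlowupTypeIMorrey
import Summits.NavierStokesRegularity.NavierStokesRegularity.Theorems.TypeICertificateLadderCertificateSoundnessLemmas
import Summits.NavierStokesRegularity.NavierStokesRegularity.Theorems.TypeICertificateLadderTypeIConcentrationBP

/-! # Lower pinching of the adapted enstrophy — crux stmt-NavierStokesRegularity-10493
(`AdaptedFrequency.AdaptedFrequencyConverges`), line tauberian-omega-limit, stub `stub_pinchingLower`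

PROVED: the registered stub `stub_pinchingLower` of line `tauberian-omega-limit` — at a
backward-singular point `(T, x₀)` of a Type-I classical Leray–Hopf solution from a rapidly decaying
datum, for every Gaussian-comparable flow-adapted kernel `G` on `[t₀, T)`, the adapted enstrophy
`H(t) = ∫ ‖curl u(t)‖² G(t)` satisfies `c₀ ≤ (T−t)² H(t)` on some `[t₁, T)` with `c₀ > 0` (the
kernel-weighted enstrophy blows up at least at the self-similar rate at EVERY late time).

This is the FAR-FIELD step of the line: on the exact infinite-energy linear Navier–Stokes witness
of the crux Disproof (`Cruxes/AdaptedFrequencyConverges/Disproof.lean`, §1–§2) one has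
`(1−t)² H → 0`, so no `G`-local argument can work; the proof below uses the finite energy exactly
once, through the Morrey-type bound of Type-I Leray–Hopf solutions (`morrey_of_typeI`,
Seregin–Šverák 2009 Lemma 3.5 / Barker–Prange (e.typeI)), and the backward singularity exactly
once, through the `L³` CONCENTRATION at the similarity scale at the singular point (Barker–Prange
2020, Thm. 2, PROVED in the tree: `BarkerPrange2020_thm2_holds`; packaged at a prescribed point in
`pinchingLower_L3_concentration`). Outline (by contradiction, at ONE late time `t` with
`(T−t)² H(t)` small, in physical variables, `λ = √(T−t)`): Gaussian lower comparability makes the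
scale-invariant local enstrophy `λ ∫_{B(x₀,3aλ)} ‖ω‖²` small; by Tao's local Biot–Savart law and
Poincaré, `u(t)` is then `L²`-close on `B(x₀, bλ)` to its mean `m` up to the Type-I sup-norm
remainder `O(C b/a)`; the Morrey bound forces `λ|m| ≲ √M₀/b`; so `∫_{B(x₀,ρλ)} ‖u(t)‖³` is as
small as we please for `1 ≪ b ≪ a`, contradicting the `L³` concentration. No tangent flow,
compactness or persistence-of-singularities argument is needed beyond what Barker–Prange's theorem
already contains. The analytic one-time estimate lives in the sibling file
`…StubPinchingLowerTools.lean` (`pinchingLower_key_estimate`).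

Sources: T. Barker, C. Prange, ARMA 236 (2020), Thm. 2 (arXiv:1812.09115); T. Tao, Anal. PDE 6
(2013) §10; G. Seregin, V. Šverák, CPDE 34 (2009), Lemma 3.5; G. Koch, N. Nadirashvili,
G. Seregin, V. Šverák, Acta Math. 203 (2009) §6 (the Type-I blow-up dictionary).
-/

noncomputable section

open scoped Topology InnerProductSpace RealInnerProductSpace ENNReal
open Literature.Analysis.FluidPDE Set Filter MeasureTheory Metric Function

namespace Summit.NavierStokesRegularity.NavierStokesRegularity.Theorems.AdaptedFrequencyConverges.TauberianOmegaLimit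

/-! ### `L³` concentration at the similarity scale at a GIVEN backward-singular point -/

/-- **Barker–Prange `L³` concentration at a prescribed backward-singular point.** Let `(u, p)` be
classical on `ℝ³ × [0, T)`, Leray–Hopf from its rapidly decaying datum, with the Type-I rate at
`T`, and let `(T, x₀)` be backward-singular (`u` essentially unbounded on every backward cylinder
`Q_r(T, x₀)`). Then there are `ρ, γ > 0` and `t₁ < T` with `γ < ∫_{B(x₀, ρ√(T−t))} ‖u(t)‖³` for
all `t₁ < t < T`. Proof: the Morrey-type bound of a Type-I solution (`morrey_of_typeI`),
Barker–Prange 2020 Thm. 2 (`BarkerPrange2020_thm2_holds`) applied to the global Leray–Hopf graft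
of `u` (`CertificateSoundness.exists_isGlobalLerayHopf_graft`), at the GIVEN point `x₀` — the
variant of `CertificateSoundness.exists_L3_concentration_of_morrey`, which produces its own
singular point. [cite: BarkerPrange2020, Thm. 2 (arXiv:1812.09115, pp. 4–5)] -/
theorem pinchingLower_L3_concentration {ν T : ℝ}
    {u : ℝ → EuclideanSpace ℝ (Fin 3) → EuclideanSpace ℝ (Fin 3)} {p : ℝ → EuclideanSpace ℝ (Fin 3) → ℝ}
    (hν : 0 < ν) (hT : 0 < T) (hsol : IsClassicalNSSolutionOn (Ico 0 T) ν 0 u p)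
    (hLH : IsLerayHopfOn T ν 0 (u 0) u) (h₀ : HasRapidSpatialDecay (u 0)) (hI : IsTypeIBlowup u T)
    {x₀ : EuclideanSpace ℝ (Fin 3)}
    (hsing : ∀ r : ℝ, 0 < r →
      eLpNorm (uncurry u) ⊤ (volume.restrict (parabolicCylinder r (T, x₀))) = ⊤) :
    ∃ ρ γ t₁ : ℝ, 0 < ρ ∧ 0 < γ ∧ t₁ < T ∧
      ∀ t ∈ Ioo t₁ T, γ < ∫ x in ball x₀ (ρ * Real.sqrt (T - t)), ‖u t x‖ ^ 3 := by
  obtain ⟨r₀, M₀, T₁, hr₀, hT₁, hMor⟩ := morrey_of_typeI hν hT hsol hLH hI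
  obtain ⟨γ, hγ, hBP⟩ := BarkerPrange2020_thm2_holds
  set M : ℝ := Real.sqrt (max M₀ 1) / ν with hM_def
  have hMpos : 0 < M := by positivity
  obtain ⟨S, hS, -, hBP'⟩ := hBP M hMpos
  set T₁' : ℝ := max T₁ 0 with hT₁'_def
  have hT₁'T : T₁' < T := max_lt hT₁ hT
  set r₁ : ℝ := min r₀ (Real.sqrt (ν * (T - T₁'))) with hr₁_def
  have hr₁ : 0 < r₁ := lt_min hr₀ (Real.sqrt_pos.2 (mul_pos hν (sub_pos.2 hT₁'T)))
  obtain ⟨tStar, -, htStarT, -, hBP''⟩ :=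
    hBP' ν T hν hT (ENNReal.ofReal r₁) (ENNReal.ofReal_pos.2 hr₁)
  obtain ⟨v, hv, hvu⟩ := CertificateSoundness.exists_isGlobalLerayHopf_graft hν hT hsol hLH h₀
  -- (i) the Morrey bound in `L²` form for `v`
  have hMorv : ∀ (y : EuclideanSpace ℝ (Fin 3)) (r : ℝ), 0 < r →
      ENNReal.ofReal r < ENNReal.ofReal r₁ → ∀ t : ℝ, 0 < t → T - r ^ 2 / ν < t → t < T →
        eLpNorm (v t) 2 (volume.restrict (ball y r)) ≤ ENNReal.ofReal (M * ν * Real.sqrt r) := by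
    intro y r hr hrr₁ t ht0 htr htT
    have hr' : r < r₁ := (ENNReal.ofReal_lt_ofReal_iff hr₁).1 hrr₁
    have hrr₀ : r ≤ r₀ := hr'.le.trans (min_le_left _ _)
    have hT₁t : T₁ < t := by
      have h1 : r < Real.sqrt (ν * (T - T₁')) := hr'.trans_le (min_le_right _ _)
      have h2 : r ^ 2 < ν * (T - T₁') := by
        calc r ^ 2 < Real.sqrt (ν * (T - T₁')) ^ 2 := by gcongr
          _ = ν * (T - T₁') := Real.sq_sqrt (by positivity)
      have h3 : r ^ 2 / ν < T - T₁' := by rw [div_lt_iff₀ hν]; linarith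
      linarith [le_max_left T₁ 0]
    rw [hvu t htT]
    have hint := hMor t ⟨hT₁t, htT⟩ y r hr hrr₀
    have hmem : MemLp (u t) 2 (volume.restrict (ball y r)) :=
      (hLH.memLp t ⟨ht0.le, htT.le⟩).restrict _
    rw [hmem.eLpNorm_eq_integral_rpow_norm two_ne_zero ENNReal.ofNat_ne_top]
    refine ENNReal.ofReal_le_ofReal ?_
    simp only [ENNReal.toReal_ofNat, Real.rpow_two]
    rw [show ((2 : ℝ)⁻¹) = 1 / 2 by norm_num, ← Real.sqrt_eq_rpow]
    calc Real.sqrt (∫ x in ball y r, ‖u t x‖ ^ 2) ≤ Real.sqrt (max M₀ 1 * r) :=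
          Real.sqrt_le_sqrt (hint.trans (by gcongr; exact le_max_left _ _))
      _ = M * ν * Real.sqrt r := by
          rw [Real.sqrt_mul (by positivity), hM_def]
          field_simp
  -- (ii) every point of the open strip is regular
  have hreg : ∀ t ∈ Ioo 0 T, ∀ x : EuclideanSpace ℝ (Fin 3), IsRegularPoint v (t, x) := by
    intro t ht x
    have hT₂ : (t + T) / 2 ∈ Ioo 0 T := ⟨by linarith [ht.1], by linarith [ht.2]⟩
    obtain ⟨K, hK⟩ :=
      exists_forall_norm_le_of_tao2011 tao2011_hasBoundedSobolevNormsOn_holds hν hsol hLH h₀ _ hT₂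
    set ρ : ℝ := min (Real.sqrt t) (Real.sqrt ((t + T) / 2 - t)) with hρ_def
    have hρ : 0 < ρ := lt_min (Real.sqrt_pos.2 ht.1) (Real.sqrt_pos.2 (by linarith [ht.2]))
    have hρt : ρ ^ 2 ≤ t := by
      calc ρ ^ 2 ≤ Real.sqrt t ^ 2 := by gcongr; exact min_le_left _ _
        _ = t := Real.sq_sqrt ht.1.le
    have hρT : ρ ^ 2 ≤ (t + T) / 2 - t := by
      calc ρ ^ 2 ≤ Real.sqrt ((t + T) / 2 - t) ^ 2 := by gcongr; exact min_le_right _ _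
        _ = (t + T) / 2 - t := Real.sq_sqrt (by linarith [ht.2])
    refine isRegularPoint_of_ae_bound_superset (S := Icc 0 ((t + T) / 2) ×ˢ univ) (C := K) hρ
      ?_ ?_
    · intro w hw
      rw [mem_parabolicCylinderCentered] at hw
      exact ⟨⟨by linarith [hw.1.1], by linarith [hw.1.2]⟩, mem_univ _⟩
    · filter_upwards [ae_restrict_mem (measurableSet_Icc.prod MeasurableSet.univ)] with w hw
      rw [hvu w.1 (lt_of_le_of_lt hw.1.2 hT₂.2)]
      exact hK w.1 hw.1 w.2
  -- (iii) `(T, x₀)` is singular for `v` as well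
  have hsing' : ∀ r : ℝ, 0 < r → r ^ 2 < T →
      eLpNorm (uncurry v) ⊤ (volume.restrict (parabolicCylinder r ((T : ℝ), x₀))) = ⊤ := by
    intro r hr _
    refine (eLpNorm_congr_ae ?_).trans (hsing r hr)
    filter_upwards [ae_restrict_mem (isOpen_parabolicCylinder r ((T : ℝ), x₀)).measurableSet]
      with z hz
    obtain ⟨s, y⟩ := z
    rw [mem_parabolicCylinder] at hz
    simp only [uncurry_apply_pair, hvu s hz.1.2]
  -- Barker–Prange at `(T, x₀)`
  have hconc := hBP'' (u 0) v hv hMorv hreg x₀ hsing'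
  refine ⟨(2 / Real.sqrt S + 1) * Real.sqrt ν, (γ * ν) ^ 3, max tStar 0, by positivity,
    by positivity, max_lt htStarT hT, fun t ht => ?_⟩
  have ht0 : 0 < t := lt_of_le_of_lt (le_max_right _ _) ht.1
  have htS : tStar < t := lt_of_le_of_lt (le_max_left _ _) ht.1
  have h1 := hconc t ⟨htS, ht.2⟩
  rw [hvu t ht.2] at h1
  -- enlarge the closed ball to the open ball of radius `(2/√S + 1) √ν √(T - t)`
  set R : ℝ := (2 / Real.sqrt S + 1) * Real.sqrt ν * Real.sqrt (T - t) with hR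
  have hsub : closedBall x₀ (2 * Real.sqrt (ν * (T - t) / S)) ⊆ ball x₀ R := by
    refine closedBall_subset_ball ?_
    have hpos : 0 < Real.sqrt (ν * (T - t)) := Real.sqrt_pos.2 (mul_pos hν (sub_pos.2 ht.2))
    rw [Real.sqrt_div' (ν * (T - t)) hS.le, hR, mul_assoc, ← Real.sqrt_mul hν.le]
    have : (2 / Real.sqrt S + 1) * Real.sqrt (ν * (T - t)) =
        2 * (Real.sqrt (ν * (T - t)) / Real.sqrt S) + Real.sqrt (ν * (T - t)) := by ring
    rw [this]
    linarith
  have h2 : ENNReal.ofReal (γ * ν) < eLpNorm (u t) 3 (volume.restrict (ball x₀ R)) :=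
    lt_of_lt_of_le h1 (eLpNorm_mono_measure _ (Measure.restrict_mono hsub le_rfl))
  -- from the `L³` norm to the integral of the cube
  have hcont : Continuous (u t) := (hsol.contDiff_velocity ⟨ht0.le, ht.2⟩).continuous
  rw [eLpNorm_eq_lintegral_rpow_enorm_toReal (by norm_num) (by norm_num), ENNReal.toReal_ofNat] at h2
  have e3 : ∀ x, ‖u t x‖ₑ ^ (3 : ℝ) = ‖u t x‖ₑ ^ (3 : ℕ) := fun x => by
    rw [show (3 : ℝ) = ((3 : ℕ) : ℝ) by norm_num, ENNReal.rpow_natCast]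
  simp only [e3] at h2
  rw [typeIConc_lintegral_ball_enorm_pow_eq hcont x₀ R 3] at h2
  have h3 : ENNReal.ofReal (γ * ν) ^ (3 : ℝ) <
      ((ENNReal.ofReal (∫ x in ball x₀ R, ‖u t x‖ ^ 3)) ^ (1 / (3 : ℝ))) ^ (3 : ℝ) :=
    ENNReal.rpow_lt_rpow h2 (by norm_num)
  rw [← ENNReal.rpow_mul, one_div, inv_mul_cancel₀ (by norm_num : (3 : ℝ) ≠ 0), ENNReal.rpow_one,
    ENNReal.ofReal_rpow_of_nonneg (by positivity) (by norm_num)] at h3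
  have h4 := (ENNReal.ofReal_lt_ofReal_iff_of_nonneg (by positivity)).1 h3
  rwa [show (3 : ℝ) = ((3 : ℕ) : ℝ) by norm_num, Real.rpow_natCast] at h4

/-! ### The stub: lower pinching of the adapted enstrophy -/

/-- **Lower pinching** `0 < c₀ ≤ (T−t)² H(t)` near `T` for the adapted enstrophy
`H(t) = ∫ ‖curl u(t)‖² G(t)` at a backward-singular point `(T, x₀)` of a Type-I classical
Leray–Hopf solution, `G` any Gaussian-comparable adapted kernel — the FAR-FIELD step of line
`tauberian-omega-limit` (it fails for the infinite-energy linear witness of the crux Disproof, where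
`(1−t)² H → 0`). Proof by contradiction at ONE late time `t` with `(T−t)² H(t)` small, entirely in
physical variables at the similarity scale `λ = √(T−t)`: (1) Gaussian lower comparability turns the
smallness of `(T−t)² H(t)` into smallness of the scale-invariant local enstrophy
`λ ∫_{B(x₀, 3aλ)} ‖ω‖²` (`pinchingLower_ball_enstrophy_le`; finiteness of the weighted enstrophy by
Tao's Sobolev bounds); (2) Tao's local Biot–Savart law and the Poincaré inequality make `u(t)`
`L²`-close on `B(x₀, bλ)` to its mean `m`, up to the Type-I sup-norm remainder `O(C b/a)`;
(3) the Morrey-type bound of Type-I Leray–Hopf solutions (`morrey_of_typeI`, the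
far-field/finite-energy input) forces `λ|m| ≲ √M₀/b`; (4) hence `∫_{B(x₀, ρλ)} ‖u(t)‖³` is as
small as we please for `1 ≪ b ≪ a` — contradicting the `L³` concentration at the similarity scale
at the singular point (Barker–Prange 2020, Thm. 2, `pinchingLower_L3_concentration`).
[cite: BarkerPrange2020, Thm. 2; Tao2011, §10 (local Biot–Savart law)] -/
theorem stub_pinchingLower : ∀ (ν T : ℝ) (u : ℝ → EuclideanSpace ℝ (Fin 3) → EuclideanSpace ℝ (Fin 3)) (p : ℝ → EuclideanSpace ℝ (Fin 3) → ℝ) (x₀ : EuclideanSpace ℝ (Fin 3)) (t₀ : ℝ) (G : ℝ → EuclideanSpace ℝ (Fin 3) → ℝ), 0 < ν → 0 < T → IsClassicalNSSolutionOn (Ico 0 T) ν 0 u p → IsLerayHopfOn T ν 0 (u 0) u → HasRapidSpatialDecay (u 0) → IsTypeIBlowup u T → t₀ ∈ Ico 0 T → (∀ r : ℝ, 0 < r → eLpNorm (Function.uncurry u) ⊤ (volume.restrict (parabolicCylinder r (T, x₀))) = ⊤) → IsAdaptedBackwardKernel ν u (Ico t₀ T) T x₀ G → IsGaussianComparable G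 (Ico t₀ T) T x₀ → ∃ t₁ ∈ Ico t₀ T, ∃ c₀ : ℝ, 0 < c₀ ∧ ∀ t ∈ Ico t₁ T, c₀ ≤ (T - t) ^ 2 * adaptedEnstrophy u G t := by
  intro ν T u p x₀ t₀ G hν hT hsol hLH hdec hTI ht₀ hsing hker hcmp
  -- the four analytic inputs
  obtain ⟨c₁, c₂, C₁, C₂, hc₁, hc₂, hC₁, hC₂, hGcmp⟩ := isGaussianComparable_iff_fin_three.1 hcmp
  obtain ⟨C, δ, hC0, hδ, -, hrate⟩ := exists_typeI_rate_window hT hTI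
  obtain ⟨r₀, M₀, T₁, hr₀, hT₁T, hMor⟩ := morrey_of_typeI hν hT hsol hLH hTI
  obtain ⟨ρc, γ, t₁c, hρc, hγ, ht₁cT, hconc⟩ :=
    pinchingLower_L3_concentration hν hT hsol hLH hdec hTI hsing
  -- constants and scales `1 ≤ b ≤ a`
  obtain ⟨P, hP⟩ : ∃ P : ℝ, P = 486 * (1 + regLaplacianMass ^ 2) := ⟨_, rfl⟩
  obtain ⟨V₁, hV₁⟩ : ∃ V₁ : ℝ, V₁ = volume.real (ball (0 : EuclideanSpace ℝ (Fin 3)) 1) := ⟨_, rfl⟩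
  obtain ⟨Mp, hMp⟩ : ∃ Mp : ℝ, Mp = max M₀ 0 := ⟨_, rfl⟩
  have hMp0 : 0 ≤ Mp := by rw [hMp]; exact le_max_right _ _
  have hM₀Mp : M₀ ≤ Mp := by rw [hMp]; exact le_max_left _ _
  obtain ⟨b, hb⟩ : ∃ b : ℝ, b = ρc + 1 + 16 * C * ρc ^ 3 * Mp / γ := ⟨_, rfl⟩
  have hbaux : 0 ≤ 16 * C * ρc ^ 3 * Mp / γ := by positivity
  have hb1 : 1 ≤ b := by rw [hb]; linarith
  have hbpos : 0 < b := by linarith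
  have hbρ : ρc ≤ b := by rw [hb]; linarith
  have hbkey : 4 * C * ρc ^ 3 * Mp / b ^ 2 ≤ γ / 4 := by
    have h1 : 16 * C * ρc ^ 3 * Mp / γ ≤ b := by rw [hb]; linarith
    have h2 : 16 * C * ρc ^ 3 * Mp ≤ γ * b := by rwa [div_le_iff₀' hγ] at h1
    have h3 : γ * b ≤ γ * b ^ 2 := by
      have : b ≤ b ^ 2 := by nlinarith
      exact mul_le_mul_of_nonneg_left this hγ.le
    rw [div_le_iff₀ (by positivity)]
    linarith
  obtain ⟨A₂, hA₂⟩ : ∃ A₂ : ℝ, A₂ = 576 * V₁ * lamGradL1 ^ 2 * C ^ 2 := ⟨_, rfl⟩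
  have hA₂0 : 0 ≤ A₂ := by rw [hA₂, hV₁]; positivity
  obtain ⟨a, ha⟩ : ∃ a : ℝ, a = b + 24 * C * A₂ * b ^ 5 / γ := ⟨_, rfl⟩
  have haaux : 0 ≤ 24 * C * A₂ * b ^ 5 / γ := by positivity
  have hab : b ≤ a := by rw [ha]; linarith
  have hapos : 0 < a := lt_of_lt_of_le hbpos hab
  have hakey : 6 * C * (A₂ * b ^ 5 / a ^ 2) ≤ γ / 4 := by
    have h1 : 24 * C * A₂ * b ^ 5 / γ ≤ a := by rw [ha]; linarith
    have h2 : 24 * C * A₂ * b ^ 5 ≤ γ * a := by rwa [div_le_iff₀' hγ] at h1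
    have h3 : γ * a ≤ γ * a ^ 2 := by
      have : a ≤ a ^ 2 := by nlinarith
      exact mul_le_mul_of_nonneg_left this hγ.le
    rw [mul_div_assoc', div_le_iff₀ (by positivity)]
    linarith
  -- the smallness threshold `c₀`
  obtain ⟨A₁, hA₁⟩ : ∃ A₁ : ℝ, A₁ = 64 * P * b ^ 2 * (c₁⁻¹ * Real.exp ((3 * a) ^ 2 / c₂)) :=
    ⟨_, rfl⟩
  have hA₁0 : 0 ≤ A₁ := by rw [hA₁, hP]; positivity
  obtain ⟨c₀, hc₀⟩ : ∃ c₀ : ℝ, c₀ = γ / (4 * (6 * C * A₁ + 1)) := ⟨_, rfl⟩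
  have hc₀pos : 0 < c₀ := by rw [hc₀]; positivity
  have hckey : ∀ h : ℝ, h < c₀ → 6 * C * (A₁ * h) ≤ γ / 4 := by
    intro h hh
    have h1 : (6 * C * A₁ + 1) * c₀ = γ / 4 := by rw [hc₀]; field_simp
    have h2 : 6 * C * A₁ * h ≤ 6 * C * A₁ * c₀ := mul_le_mul_of_nonneg_left hh.le (by positivity)
    nlinarith
  -- the threshold time
  obtain ⟨t₁, ht₁⟩ : ∃ t₁ : ℝ, t₁ = max (max t₀ (T - (r₀ / b) ^ 2))
    (max (max (T - δ / 2) ((T₁ + T) / 2)) (max ((t₁c + T) / 2) (T / 2))) := ⟨_, rfl⟩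
  have hrb : 0 < (r₀ / b) ^ 2 := by positivity
  have ht₁T : t₁ < T := by
    rw [ht₁]
    exact max_lt (max_lt ht₀.2 (by linarith)) (max_lt (max_lt (by linarith) (by linarith))
      (max_lt (by linarith) (by linarith)))
  have ht₀t₁ : t₀ ≤ t₁ := by rw [ht₁]; exact (le_max_left _ _).trans (le_max_left _ _)
  refine ⟨t₁, ⟨ht₀t₁, ht₁T⟩, c₀, hc₀pos, fun t ht => ?_⟩
  by_contra hlt
  have hlt' : (T - t) ^ 2 * adaptedEnstrophy u G t < c₀ := not_le.1 hlt
  -- the time `t` and its constraints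
  have htT : t < T := ht.2
  have hTt : 0 < T - t := sub_pos.2 htT
  have hle : ∀ s : ℝ, s ≤ t₁ → s ≤ t := fun s hs => hs.trans ht.1
  have ht₀t : t₀ ≤ t := hle _ ht₀t₁
  have htr : T - t ≤ (r₀ / b) ^ 2 := by
    have := hle (T - (r₀ / b) ^ 2) (by rw [ht₁]; exact (le_max_right _ _).trans (le_max_left _ _))
    linarith
  have htδ : T - δ < t := by
    have := hle (T - δ / 2)
      (by rw [ht₁]; exact ((le_max_left _ _).trans (le_max_left _ _)).trans (le_max_right _ _))
    linarith
  have hT₁t : T₁ < t := by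
    have := hle ((T₁ + T) / 2)
      (by rw [ht₁]; exact ((le_max_right _ _).trans (le_max_left _ _)).trans (le_max_right _ _))
    linarith
  have ht₁ct : t₁c < t := by
    have := hle ((t₁c + T) / 2)
      (by rw [ht₁]; exact ((le_max_left _ _).trans (le_max_right _ _)).trans (le_max_right _ _))
    linarith
  have ht0 : 0 < t := by
    have := hle (T / 2)
      (by rw [ht₁]; exact ((le_max_right _ _).trans (le_max_right _ _)).trans (le_max_right _ _))
    linarith
  have htS : t ∈ Ico t₀ T := ⟨ht₀t, htT⟩
  -- the similarity scale
  obtain ⟨lam, hlam⟩ : ∃ lam : ℝ, lam = Real.sqrt (T - t) := ⟨_, rfl⟩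
  have hlampos : 0 < lam := by rw [hlam]; exact Real.sqrt_pos.2 hTt
  have hlam2 : lam ^ 2 = T - t := by rw [hlam]; exact Real.sq_sqrt hTt.le
  have hpow : (T - t) ^ ((3:ℝ) / 2) = (T - t) * lam := by
    rw [show (3:ℝ) / 2 = 1 + 1 / 2 by norm_num, Real.rpow_add hTt, Real.rpow_one, hlam,
      Real.sqrt_eq_rpow]
  have hblam : b * lam ≤ r₀ := by
    have h1 : lam ≤ r₀ / b := by
      rw [hlam, ← Real.sqrt_sq (by positivity : 0 ≤ r₀ / b)]
      exact Real.sqrt_le_sqrt htr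
    rwa [le_div_iff₀' hbpos] at h1
  -- the solution at time `t`
  have hsmooth : ContDiff ℝ (⊤ : ℕ∞) (u t) := hsol.contDiff_velocity ⟨ht₀.1.trans ht₀t, htT⟩
  have hdiv : VectorCalculus.IsDivFree (u t) := hsol.divFree t ⟨ht₀.1.trans ht₀t, htT⟩
  have hs : ∀ y, ‖u t y‖ ≤ C / lam := fun y => by
    rw [le_div_iff₀ hlampos, mul_comm, hlam]
    exact hrate t ⟨htδ, htT⟩ y
  -- (1) the local enstrophy is small
  obtain ⟨H, hH⟩ : ∃ H : ℝ, H = adaptedEnstrophy u G t := ⟨_, rfl⟩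
  have hH0 : 0 ≤ H := by rw [hH]; exact adaptedEnstrophy_nonneg fun x => (hker.pos t htS x).le
  have hGt : ∀ x, c₁ * (T - t) ^ (-(3:ℝ) / 2) * Real.exp (-(‖x - x₀‖ ^ 2) / (c₂ * (T - t))) ≤
      G t x := fun x => (hGcmp t htS x).1
  have hGup : ∀ x, |G t x| ≤ C₁ * (T - t) ^ (-(3:ℝ) / 2) := fun x => by
    rw [abs_of_pos (hker.pos t htS x)]
    refine (hGcmp t htS x).2.trans (mul_le_of_le_one_right (by positivity) ?_)
    refine Real.exp_le_one_iff.2 ?_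
    rw [neg_div]
    exact neg_nonpos.2 (by positivity)
  have hint : Integrable (fun x => ‖curl (u t) x‖ ^ 2 * G t x) :=
    pinchingLower_integrable_enstrophy_mul hν hsol hLH hdec ⟨ht0, htT⟩
      (hker.contDiff_slice htS).continuous hGup
  have hW : ∫ x in ball x₀ (3 * a * lam), ‖curl (u t) x‖ ^ 2 ≤
      c₁⁻¹ * Real.exp ((3 * a) ^ 2 / c₂) * (T - t) ^ ((3:ℝ) / 2) * H := by
    rw [hlam, hH]
    exact pinchingLower_ball_enstrophy_le hc₁ hc₂ htT hGt
      (continuous_curl (hsmooth.of_le (by exact_mod_cast le_top))) hint (3 * a)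
  -- (2)–(4) the one-time estimate, and the contradiction
  have hMort : ∫ x in ball x₀ (b * lam), ‖u t x‖ ^ 2 ≤ Mp * (b * lam) :=
    (hMor t ⟨hT₁t, htT⟩ x₀ (b * lam) (by positivity) hblam).trans
      (mul_le_mul_of_nonneg_right hM₀Mp (by positivity))
  have hγlt := hconc t ⟨ht₁ct, htT⟩
  rw [← hlam] at hγlt
  have hkey := pinchingLower_key_estimate hsmooth hdiv hC0 hlampos hρc hbρ hab hs hMort hW hγlt
  rw [← hP, ← hV₁] at hkey
  have h1 : 64 * P * b ^ 2 * lam * (c₁⁻¹ * Real.exp ((3 * a) ^ 2 / c₂) * (T - t) ^ ((3:ℝ) / 2) * H) =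
      A₁ * ((T - t) ^ 2 * H) := by
    rw [hpow, hA₁, ← hlam2]; ring
  have h2 : 576 * V₁ * lamGradL1 ^ 2 * C ^ 2 * b ^ 5 / a ^ 2 = A₂ * b ^ 5 / a ^ 2 := by rw [hA₂]
  rw [h1, h2, mul_add, hH] at hkey
  have h3 := hckey _ hlt'
  linarith

end Summit.NavierStokesRegularity.NavierStokesRegularity.Theorems.AdaptedFrequencyConverges.TauberianOmegaLimit

end
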